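/-
Copyright (c) 2026 the pub-hodgecm-mathlib formalisation cell (harness21).  Prover seat hodgecm-mathlib-K2E1-p13 (g2), Track B ∕ K2-LIT, h413 = `stmt-HodgeConjecture-24833`,
line `K2_E1_TraceFormulaBeta`, ROADCARD «5Res ENDGAME BY FAMILIES» C3 second half (dealer K2E1-plan (g7) (210)): the unitary-axis regularity and the Plancherel form of a
SELF-DUAL scattering scalar, GENERIC in `(P, c)` — the kernel-free twin of ★ (136) `K2E1ScalarUnitaryAxisContinuationCMTwo` and of ★ P2 `K2E1PseudoEisensteinPlancherelRadialCMTwo`.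
-/
import Summits.HodgeConjecture.HodgeConjecture.Theorems.K2E1PseudoEisensteinPlancherelRadialCMTwo      -- ★ P2 p859946 (this seat): `tendsto_axis_nhdsNE`, `eventually_axis_notMem`; brings ★ (136), ★ T2, ★ T5a ED. 2
import Summits.HodgeConjecture.HodgeConjecture.Theorems.K2E1PseudoEisensteinContourShiftMultiCMTwo     -- ★ T4b-multi p859979 (K2E4-p11): `pseudoEisenstein_contourShift_multi_of_letters`, `integrable_innerProductIntegrand_vertical_of_finset`
import HarnessLib

/-!
# C3 (second half) — `K2E1ChiUnitaryAxisContinuationCMTwo`: a SELF-DUAL scattering scalar is analytic and unitary on the axis `Re z = ½`, and its pseudo-Eisenstein inner products take the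
# Plancherel form — GENERIC in the pole set `P` and the scalar `c`, modulo the letters (FE), (conj) and the right-half-plane pole finset

Track B ∕ K2-LIT, crux h413 = `stmt-HodgeConjecture-24833`, route of record `HCCMUnconditional`; cell `hodgecm-mathlib`, squad K2, ENGINE E1.  THEOREMS ONLY (no `def`, no `instance`,
no `notation`, no `sorry`; default heartbeats); lane `--supports stmt-HodgeConjecture-24833 --as helper` (count-neutral).  No automorphic object: complex analysis on `(P, c)`.

THE MATHEMATICS ([MoeglinWaldspurger1995, IV.1.10–IV.1.11, IV.3.12]; [Iwaniec2002, §6.3 Thm 6.6, §7.3]; [Langlands1976, §7]).  A SELF-DUAL unramified family (`χ·(χ∘c) = 1`, i.e. `χʷ = χ`,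
level `K_max`, `dim V(χ) = 1` — the M1 datum) has a scalar scattering coefficient `c(z) = c(z; χ)`: NF-meromorphic on `ℂ`, analytic off ONE closed co-discrete `P ⊆ {Re ≤ 1}` (★ X2_χ core
`chiEisenstein_meromorphic_exports_core_of_packages`, coefficient pieces `qc j`), with the functional equation **(hFE)** `c(z)·c(1 − z) = 1` off `P ∪ (1 − P)` (★ C3 FILE 1
`coeff_mul_coeff_apply_eq_of_packages` at one package, `χʷ = χ`; FILE 2 pays it on ★ §2b's packages), the reflection symmetry **(hconj)** `c(conj z) = conj c(z)` off `P ∪ conj P` (for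
`χ = 1` ★ (136) §2 from the positive real kernel; for self-dual `χ` from Galois-conjugation invariance `c(w; χ∘c) = c(w; χ)` — a separate payer), and in `{½ < Re}` at most a finite set
`S` of real simple poles **(hright)** ((b)(c)(d) blocks: pole exclusion, no complex pole, arch unitarity).  THIS FILE, generic in `(P, c)` and these three letters:
* §1 **`analyticAt_of_re_eq_half_of_fe_of_conj`** — NO POLE ON THE AXIS: a pole at `z₀`, `Re z₀ = ½`, forces `‖c‖ → ∞` on `𝓝[≠] z₀` (normal form, negative order), but along the axis
  `z₀ + it`, `t ≠ 0` small (off `P`, `1 − P`, `conj P` by co-discreteness) `1 − z = conj z`, so (FE) + (conj) give `‖c z‖ = 1` (★ T2 `norm_eq_one_of_mul_one_sub_eq_one`) — ★ (136) §3 made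
  KERNEL-FREE (their §2 enters only through its conclusion).
* §2 ON THE AXIS AT EVERY POINT (continuity across the exceptional points, limits along `𝓝[≠] t` unique — ★ P2's device): `continuous_axis_of_fe_of_conj`,
  **`norm_axis_eq_one_of_fe_of_conj`** (`‖c(½ + it)‖ = 1` ∀ t = ★ T5a's `hs1`), **`axis_reflect_of_fe_of_conj`** (`c(½ − it) = conj c(½ + it)` ∀ t = `hss`).
* §3 **`exists_isOpen_differentiableOn_of_fe_of_conj_finset`** — with (hright): `∃ U` open `⊇ {Re ≥ ½}` with `c` differentiable on `U ∖ S` — EXACTLY ★ T4b-multi's letters `hUo hUs hs`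
  for every `σ₀` (`U = {analytic points} ∪ {Re > ½}`).
* §4 **`pseudoEisenstein_plancherelForm_finset_of_fe_of_conj`** — THE PLANCHEREL FORM OF A SELF-DUAL FAMILY: ★ T4b-multi `pseudoEisenstein_contourShift_multi_of_letters` (contour shift
  `σ₀ → ½` across the finset `S`, residues `r`) then ★ T5a ED. 2 `plancherelForm_of_innerProductFormula_finset` at `(ι, J, z, ρ, Φ, Ψ, s) := (ℝ, S, id, r, mellin f, mellin f′, c)` with
  `hs1`, `hss` from §2 and `hG` = ★ `integrable_innerProductIntegrand_vertical_of_finset` at `σ = ½`: **`IP = C·Σ_{x∈S} r_x·f̃(−x)·conj f̃′(−x) + C·(2π)⁻¹·∫_0^∞ U_f(t)·conj U_{f′}(t) dt`**,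
  `U_f(t) = f̃(−(½+it)) + c(½−it)·f̃(−(½−it))`; and the NORM form `pseudoEisenstein_plancherelNorm_finset_of_fe_of_conj` — the isometry clause of ROADCARD T5∕D4′c (SD) for the family,
  remaining letters `hFE hconj hright hr hB hIP` (all with named payers).
HONEST LABEL: HC_CM is proved only modulo the 7 printed citations (2 remaining named inputs: hLiu418 = `stmt-HodgeConjecture-24832`, h413 = `stmt-HodgeConjecture-24833`) until rung 0
closes; this file asserts no named fact, closes no socket; count-neutral; letters `hFE`, `hconj`, `hright`, `hr`, `hB`, `hIP`.

## References
* [MoeglinWaldspurger1995] C. Mœglin, J.-L. Waldspurger, *Spectral decomposition and Eisenstein series* (1995), IV.1.10–IV.1.11, IV.3.12.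
* [Iwaniec2002] H. Iwaniec, *Spectral Methods of Automorphic Forms* (2nd ed., 2002), §6.3 Thm 6.6, §7.3.
* [Langlands1976] R. P. Langlands, *On the Functional Equations Satisfied by Eisenstein Series*, LNM 544 (1976), §7.
-/

set_option autoImplicit false
set_option linter.dupNamespace false  -- the mandated namespace repeats the summit's segment (`HodgeConjecture.HodgeConjecture`)

noncomputable section

open MeasureTheory Measure Set Filter Topology Complex
open scoped Real ComplexConjugate
open Summit.HodgeConjecture.HodgeConjecture.Cruxes.H413.K2E1MellinPaleyWienerHalfLine (conj_vertical)
open Summit.HodgeConjecture.HodgeConjecture.Cruxes.H413.K2E1ScatteringUnitaryAxisCMTwo (norm_eq_one_of_mul_one_sub_eq_one)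
open Summit.HodgeConjecture.HodgeConjecture.Cruxes.H413.K2E1ScalarUnitaryAxisContinuationCMTwo (eventually_one_sub_notMem_and_conj_notMem)
open Summit.HodgeConjecture.HodgeConjecture.Cruxes.H413.K2E1PseudoEisensteinPlancherelRadialCMTwo (tendsto_axis_nhdsNE eventually_axis_notMem)
open Summit.HodgeConjecture.HodgeConjecture.Cruxes.H413.K2E1PseudoEisensteinContourShiftMultiCMTwo (pseudoEisenstein_contourShift_multi_of_letters integrable_innerProductIntegrand_vertical_of_finset)
open Summit.HodgeConjecture.HodgeConjecture.Cruxes.H413.K2E1PseudoEisensteinPlancherelIsometry (plancherelForm_of_innerProductFormula_finset plancherelNorm_of_innerProductFormula_finset)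

namespace Summit.HodgeConjecture.HodgeConjecture.Cruxes.H413.K2E1ChiUnitaryAxisContinuationCMTwo

variable {P : Set ℂ} {c : ℂ → ℂ}

/-! ## §1 No pole on the unitary axis, from (FE) and (conj) — kernel-free -/

/-- **A SELF-DUAL SCATTERING SCALAR IS ANALYTIC AT EVERY POINT OF THE AXIS `Re z = ½`** (generic).  `c` meromorphic in normal form on `ℂ`, `P` co-discrete, (FE) `c(z)c(1 − z) = 1` off
`P ∪ (1 − P)`, (conj) `c(conj z) = conj c(z)` off `P ∪ conj P`.  Were `z₀` a pole, `‖c‖ → ∞` on `𝓝[≠] z₀`; but at the axis points `z₀ + it`, `t ≠ 0` small, off `P`, `1 − P`, `conj P`,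
one has `1 − z = conj z` and `‖c z‖ = 1` (★ T2 `norm_eq_one_of_mul_one_sub_eq_one`). [cite: MoeglinWaldspurger1995, IV.3.12] [cite: Iwaniec2002, Thm 6.6] -/
theorem analyticAt_of_re_eq_half_of_fe_of_conj (hcNF : MeromorphicNFOn c univ) (hPcd : ∀ z₀ : ℂ, ∀ᶠ w in 𝓝[≠] z₀, w ∉ P)
    (hFE : ∀ z : ℂ, z ∉ P → 1 - z ∉ P → c z * c (1 - z) = 1) (hconj : ∀ z : ℂ, z ∉ P → conj z ∉ P → c (conj z) = conj (c z))
    {z₀ : ℂ} (hz₀ : z₀.re = 1 / 2) : AnalyticAt ℂ c z₀ := by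
  have hNF : MeromorphicNFAt c z₀ := hcNF (mem_univ z₀)
  by_contra hna
  have hneg : meromorphicOrderAt c z₀ < 0 := lt_of_not_ge fun h => hna (hNF.meromorphicOrderAt_nonneg_iff_analyticAt.1 h)
  have hinf : Tendsto (fun w => ‖c w‖) (𝓝[≠] z₀) atTop := tendsto_norm_atTop_iff_cobounded.2 (tendsto_cobounded_of_meromorphicOrderAt_neg hneg)
  -- eventually on the punctured neighbourhood: large norm, and off `P`, `1 − P`, `conj P`
  have hev : ∀ᶠ w in 𝓝[≠] z₀, 2 ≤ ‖c w‖ ∧ w ∉ P ∧ (1 - w ∉ P ∧ conj w ∉ P) :=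
    (hinf.eventually (eventually_ge_atTop 2)).and ((hPcd z₀).and (eventually_one_sub_notMem_and_conj_notMem hPcd z₀))
  -- push along the axis `t ↦ z₀ + it`
  have hpath : Tendsto (fun t : ℝ => z₀ + (t : ℂ) * I) (𝓝[≠] 0) (𝓝[≠] z₀) := by
    have hc : Continuous fun t : ℝ => z₀ + (t : ℂ) * I := continuous_const.add (continuous_ofReal.mul continuous_const)
    have h1 : Tendsto (fun t : ℝ => z₀ + (t : ℂ) * I) (𝓝[≠] 0) (𝓝 z₀) := by
      have h := hc.tendsto 0
      simp only [ofReal_zero, zero_mul, add_zero] at h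
      exact tendsto_nhdsWithin_of_tendsto_nhds h
    refine tendsto_nhdsWithin_iff.2 ⟨h1, eventually_mem_nhdsWithin.mono fun t ht h => ht ?_⟩
    have h' := congrArg Complex.im h
    simpa using h'
  obtain ⟨t, ⟨hnorm, htP, ht1P, htcP⟩⟩ := (hpath.eventually hev).exists
  -- on the axis `1 − z = conj z`, so (FE) + (conj) give `‖c z‖ = 1`
  have hre : (z₀ + (t : ℂ) * I).re = 1 / 2 := by simp [hz₀]
  have h1 := norm_eq_one_of_mul_one_sub_eq_one (hFE _ htP ht1P) (hconj _ htP htcP) hre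
  linarith

/-! ## §2 On the axis at EVERY point: continuity, unit modulus, reflection symmetry -/

/-- **`t ↦ c(½ + it)` IS CONTINUOUS** (analytic at every axis point, §1). [cite: MoeglinWaldspurger1995, IV.3.12] -/
theorem continuous_axis_of_fe_of_conj (hcNF : MeromorphicNFOn c univ) (hPcd : ∀ z₀ : ℂ, ∀ᶠ w in 𝓝[≠] z₀, w ∉ P)
    (hFE : ∀ z : ℂ, z ∉ P → 1 - z ∉ P → c z * c (1 - z) = 1) (hconj : ∀ z : ℂ, z ∉ P → conj z ∉ P → c (conj z) = conj (c z)) :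
    Continuous fun t : ℝ => c ((((1 / 2 : ℝ)) : ℂ) + t * I) :=
  continuous_iff_continuousAt.2 fun t =>
    (analyticAt_of_re_eq_half_of_fe_of_conj hcNF hPcd hFE hconj (by simp)).continuousAt.comp (continuous_const.add (continuous_ofReal.mul continuous_const)).continuousAt

/-- **(hs1) `‖c(½ + it)‖ = 1` FOR EVERY REAL `t`.**  Generically along the axis (off `P`, `1 − P`, `conj P` — eventually on `𝓝[≠] t`, ★ P2 `eventually_axis_notMem`) by (FE) + (conj) (★ T2);
across the exceptional points by continuity (limits along `𝓝[≠] t` are unique). [cite: Iwaniec2002, §6.3, Thm 6.6] [cite: MoeglinWaldspurger1995, IV.3.12] -/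
theorem norm_axis_eq_one_of_fe_of_conj (hcNF : MeromorphicNFOn c univ) (hPcd : ∀ z₀ : ℂ, ∀ᶠ w in 𝓝[≠] z₀, w ∉ P)
    (hFE : ∀ z : ℂ, z ∉ P → 1 - z ∉ P → c z * c (1 - z) = 1) (hconj : ∀ z : ℂ, z ∉ P → conj z ∉ P → c (conj z) = conj (c z)) (t : ℝ) :
    ‖c ((((1 / 2 : ℝ)) : ℂ) + t * I)‖ = 1 := by
  have hcont : ContinuousAt (fun u : ℝ => ‖c ((((1 / 2 : ℝ)) : ℂ) + u * I)‖) t := ((continuous_axis_of_fe_of_conj hcNF hPcd hFE hconj).continuousAt).norm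
  have hev : ∀ᶠ u : ℝ in 𝓝[≠] t, ‖c ((((1 / 2 : ℝ)) : ℂ) + (u : ℂ) * I)‖ = 1 := by
    filter_upwards [eventually_axis_notMem hPcd t] with u hu
    exact norm_eq_one_of_mul_one_sub_eq_one (hFE _ hu.1 hu.2.1) (hconj _ hu.1 hu.2.2) (by simp)
  exact tendsto_nhds_unique (hcont.tendsto.mono_left nhdsWithin_le_nhds) (tendsto_const_nhds.congr' (hev.mono fun u hu => hu.symm))

/-- **(hss) `c(½ − it) = conj c(½ + it)` FOR EVERY REAL `t`** ((conj) generically on the axis, `conj (½ + it) = ½ − it`; continuity across). [cite: MoeglinWaldspurger1995, IV.1.10] [cite: Langlands1976, §7] -/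
theorem axis_reflect_of_fe_of_conj (hcNF : MeromorphicNFOn c univ) (hPcd : ∀ z₀ : ℂ, ∀ᶠ w in 𝓝[≠] z₀, w ∉ P)
    (hFE : ∀ z : ℂ, z ∉ P → 1 - z ∉ P → c z * c (1 - z) = 1) (hconj : ∀ z : ℂ, z ∉ P → conj z ∉ P → c (conj z) = conj (c z)) (t : ℝ) :
    c ((((1 / 2 : ℝ)) : ℂ) + ((-t : ℝ) : ℂ) * I) = conj (c ((((1 / 2 : ℝ)) : ℂ) + t * I)) := by
  have h1 : ContinuousAt (fun u : ℝ => c ((((1 / 2 : ℝ)) : ℂ) + ((-u : ℝ) : ℂ) * I)) t :=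
    ((continuous_axis_of_fe_of_conj hcNF hPcd hFE hconj).comp continuous_neg).continuousAt
  have h2 : ContinuousAt (fun u : ℝ => conj (c ((((1 / 2 : ℝ)) : ℂ) + u * I))) t :=
    (continuous_conj.comp (continuous_axis_of_fe_of_conj hcNF hPcd hFE hconj)).continuousAt
  have hev : ∀ᶠ u : ℝ in 𝓝[≠] t, c ((((1 / 2 : ℝ)) : ℂ) + ((-u : ℝ) : ℂ) * I) = conj (c ((((1 / 2 : ℝ)) : ℂ) + (u : ℂ) * I)) := by
    filter_upwards [eventually_axis_notMem hPcd t] with u hu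
    rw [← conj_vertical]
    exact hconj _ hu.1 hu.2.2
  exact tendsto_nhds_unique (h1.tendsto.mono_left nhdsWithin_le_nhds) ((h2.tendsto.mono_left nhdsWithin_le_nhds).congr' (hev.mono fun u hu => hu.symm))

/-! ## §3 The open neighbourhood of `{Re z ≥ ½}` off the finite right-half-plane pole set: ★ T4b-multi's letters `hUo hUs hs` -/

/-- **A SELF-DUAL SCATTERING SCALAR IS HOLOMORPHIC ON A NEIGHBOURHOOD OF `{Re z ≥ ½}` EXCEPT AT THE FINITE REAL POLE SET `S`** (generic): with (hright) «analytic on `{½ < Re} ∖ S`»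
(the (b)(c)(d) blocks: Maass–Selberg pole exclusion, no complex pole, arch unitarity), `∃ U` open, `{z | ½ ≤ Re z} ⊆ U`, `c` differentiable on `U ∖ S` — ★ T4b-multi's `hUo hUs hs` for
EVERY `σ₀` (`U = {analytic points of c} ∪ {Re > ½}`; the axis by §1). [cite: MoeglinWaldspurger1995, IV.1.11, IV.3.12] -/
theorem exists_isOpen_differentiableOn_of_fe_of_conj_finset (hcNF : MeromorphicNFOn c univ) (hPcd : ∀ z₀ : ℂ, ∀ᶠ w in 𝓝[≠] z₀, w ∉ P)
    (hFE : ∀ z : ℂ, z ∉ P → 1 - z ∉ P → c z * c (1 - z) = 1) (hconj : ∀ z : ℂ, z ∉ P → conj z ∉ P → c (conj z) = conj (c z))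
    (S : Finset ℝ) (hright : ∀ z : ℂ, 1 / 2 < z.re → z ∉ ((S.image fun x : ℝ => (x : ℂ)) : Set ℂ) → AnalyticAt ℂ c z) :
    ∃ U : Set ℂ, IsOpen U ∧ {z : ℂ | 1 / 2 ≤ z.re} ⊆ U ∧ DifferentiableOn ℂ c (U \ ((S.image fun x : ℝ => (x : ℂ)) : Set ℂ)) := by
  refine ⟨{z : ℂ | AnalyticAt ℂ c z} ∪ {z : ℂ | 1 / 2 < z.re}, (isOpen_analyticAt ℂ c).union (isOpen_lt continuous_const continuous_re), fun z hz => ?_, fun z hz => ?_⟩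
  · rcases lt_or_eq_of_le (show (1 / 2 : ℝ) ≤ z.re from hz) with h | h
    · exact Or.inr h
    · exact Or.inl (analyticAt_of_re_eq_half_of_fe_of_conj hcNF hPcd hFE hconj h.symm)
  · rcases hz.1 with h | h
    · exact h.differentiableAt.differentiableWithinAt
    · exact (hright z h hz.2).differentiableAt.differentiableWithinAt

/-! ## §4 The Plancherel form of a self-dual family (★ T4b-multi ∘ ★ T5a ED. 2), letters `hFE hconj hright hr hB hIP` -/

/-- **THE PLANCHEREL FORM `⟪θ_f, θ_{f′}⟫ = ⟪Uθ_f, Uθ_{f′}⟫` OF A SELF-DUAL FAMILY** (generic in `(P, c)`).  For `f, f′ ∈ C²_c((0,∞))`, `σ₀ > ½`, the finite real pole set `S ⊂ (½, σ₀)` of `c` in the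
right half-plane with residues `(z − x)c(z) → r_x`, the strip bound `hB` (T1-χ ★ `K2E1ChiScatteringBoundMaassSelbergU2`) and the inner-product identity `hIP` on `Re = σ₀` (the family's
f3-χ formula, ★ `K2E1ChiPseudoEisensteinInnerProductCMTwo`): **`IP = C·Σ_{x∈S} r_x·f̃(−x)·conj f̃′(−x) + C·((2π)⁻¹·∫_0^∞ U_f(t)·conj U_{f′}(t) dt)`**, `U_f(t) = f̃(−(½+it)) +
c(½−it)·f̃(−(½−it))` — ★ T4b-multi `pseudoEisenstein_contourShift_multi_of_letters` (with §3's `hUo hUs hs`), then ★ T5a `plancherelForm_of_innerProductFormula_finset` at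
`(J, z, ρ, Φ, Ψ, s) := (S, id, r, mellin f, mellin f′, c)` with §2's `hs1`, `hss` and `hG` = ★ `integrable_innerProductIntegrand_vertical_of_finset` at `σ = ½`.
[cite: MoeglinWaldspurger1995, II.2.4, IV.3.12] [cite: Iwaniec2002, §7.3] [cite: Langlands1976, §7] -/
theorem pseudoEisenstein_plancherelForm_finset_of_fe_of_conj (hcNF : MeromorphicNFOn c univ) (hPcd : ∀ z₀ : ℂ, ∀ᶠ w in 𝓝[≠] z₀, w ∉ P)
    (hFE : ∀ z : ℂ, z ∉ P → 1 - z ∉ P → c z * c (1 - z) = 1) (hconj : ∀ z : ℂ, z ∉ P → conj z ∉ P → c (conj z) = conj (c z))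
    {σ₀ : ℝ} (hσ₀ : 1 / 2 < σ₀) (S : Finset ℝ) (hS : ∀ x ∈ S, 1 / 2 < x ∧ x < σ₀)
    (hright : ∀ z : ℂ, 1 / 2 < z.re → z ∉ ((S.image fun x : ℝ => (x : ℂ)) : Set ℂ) → AnalyticAt ℂ c z)
    (r : ℝ → ℂ) (hr : ∀ x ∈ S, Tendsto (fun z : ℂ => (z - x) * c z) (𝓝[≠] (x : ℂ)) (𝓝 (r x)))
    {f f' : ℝ → ℂ} (hf : ContDiff ℝ 2 f) (hfs : HasCompactSupport f) (hf0 : tsupport f ⊆ Ioi 0)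
    (hf' : ContDiff ℝ 2 f') (hf's : HasCompactSupport f') (hf'0 : tsupport f' ⊆ Ioi 0)
    {B : ℝ} (hB : ∀ z : ℂ, 1 / 2 < z.re → z.re ≤ σ₀ → 1 ≤ |z.im| → ‖c z‖ ≤ B)
    {IP C : ℂ} (hIP : IP = C * ((((2 * π)⁻¹ : ℝ) : ℂ) * ∫ y : ℝ, mellin f (-((σ₀ : ℂ) + y * I)) *
      (conj (mellin f' (-(1 - conj ((σ₀ : ℂ) + y * I)))) + c ((σ₀ : ℂ) + y * I) * conj (mellin f' (-conj ((σ₀ : ℂ) + y * I)))))) :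
    IP = C * (∑ x ∈ S, r x * (mellin f (-((x : ℝ) : ℂ)) * conj (mellin f' (-((x : ℝ) : ℂ))))) + C * ((((2 * π)⁻¹ : ℝ) : ℂ) * ∫ t in Ioi (0 : ℝ),
      (mellin f (-((((1 / 2 : ℝ)) : ℂ) + t * I)) + c ((((1 / 2 : ℝ)) : ℂ) + ((-t : ℝ) : ℂ) * I) * mellin f (-((((1 / 2 : ℝ)) : ℂ) + ((-t : ℝ) : ℂ) * I))) *
        conj (mellin f' (-((((1 / 2 : ℝ)) : ℂ) + t * I)) + c ((((1 / 2 : ℝ)) : ℂ) + ((-t : ℝ) : ℂ) * I) * mellin f' (-((((1 / 2 : ℝ)) : ℂ) + ((-t : ℝ) : ℂ) * I)))) := by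
  obtain ⟨U, hUo, hUs, hc⟩ := exists_isOpen_differentiableOn_of_fe_of_conj_finset hcNF hPcd hFE hconj S hright
  have hUs' : {z : ℂ | 1 / 2 ≤ z.re ∧ z.re ≤ σ₀} ⊆ U := fun z hz => hUs hz.1
  have hIP' := pseudoEisenstein_contourShift_multi_of_letters hf hfs hf0 hf' hf's hf'0 hσ₀ hUo hUs' S hS hc r hr hB hIP
  have hG : Integrable fun y : ℝ => mellin f (-((((1 / 2 : ℝ)) : ℂ) + y * I)) *
      (conj (mellin f' (-(1 - conj ((((1 / 2 : ℝ)) : ℂ) + y * I)))) + c ((((1 / 2 : ℝ)) : ℂ) + y * I) * conj (mellin f' (-conj ((((1 / 2 : ℝ)) : ℂ) + y * I)))) :=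
    integrable_innerProductIntegrand_vertical_of_finset hf hfs hf0 hf' hf's hf'0 hσ₀ hUo hUs' hc (fun x hx => (hS x hx).1) hB (σ := 1 / 2) le_rfl hσ₀.le
      (fun x hx => ne_of_lt (hS x hx).1)
  exact plancherelForm_of_innerProductFormula_finset S (fun x : ℝ => x) r (mellin f) (mellin f') c hIP' (norm_axis_eq_one_of_fe_of_conj hcNF hPcd hFE hconj)
    (axis_reflect_of_fe_of_conj hcNF hPcd hFE hconj) hG

/-- **THE NORM FORM — THE ISOMETRY CLAUSE FOR A SELF-DUAL FAMILY** (`f′ = f`): `IP = C·Σ_{x∈S} r_x·|f̃(−x)|² + C·((2π)⁻¹·∫_0^∞ |U_f(t)|² dt)` — `⟪θ_f, θ_f⟫ = ‖Uθ_f‖²` in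
`ℂ^S ⊕ L²((0,∞))` with weights `((C·r_x)_x, C·(2π)⁻¹)` (ROADCARD T5 ∕ D4′c (SD)). [cite: MoeglinWaldspurger1995, IV.3.12] [cite: Iwaniec2002, §7.3] -/
theorem pseudoEisenstein_plancherelNorm_finset_of_fe_of_conj (hcNF : MeromorphicNFOn c univ) (hPcd : ∀ z₀ : ℂ, ∀ᶠ w in 𝓝[≠] z₀, w ∉ P)
    (hFE : ∀ z : ℂ, z ∉ P → 1 - z ∉ P → c z * c (1 - z) = 1) (hconj : ∀ z : ℂ, z ∉ P → conj z ∉ P → c (conj z) = conj (c z))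
    {σ₀ : ℝ} (hσ₀ : 1 / 2 < σ₀) (S : Finset ℝ) (hS : ∀ x ∈ S, 1 / 2 < x ∧ x < σ₀)
    (hright : ∀ z : ℂ, 1 / 2 < z.re → z ∉ ((S.image fun x : ℝ => (x : ℂ)) : Set ℂ) → AnalyticAt ℂ c z)
    (r : ℝ → ℂ) (hr : ∀ x ∈ S, Tendsto (fun z : ℂ => (z - x) * c z) (𝓝[≠] (x : ℂ)) (𝓝 (r x)))
    {f : ℝ → ℂ} (hf : ContDiff ℝ 2 f) (hfs : HasCompactSupport f) (hf0 : tsupport f ⊆ Ioi 0)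
    {B : ℝ} (hB : ∀ z : ℂ, 1 / 2 < z.re → z.re ≤ σ₀ → 1 ≤ |z.im| → ‖c z‖ ≤ B)
    {IP C : ℂ} (hIP : IP = C * ((((2 * π)⁻¹ : ℝ) : ℂ) * ∫ y : ℝ, mellin f (-((σ₀ : ℂ) + y * I)) *
      (conj (mellin f (-(1 - conj ((σ₀ : ℂ) + y * I)))) + c ((σ₀ : ℂ) + y * I) * conj (mellin f (-conj ((σ₀ : ℂ) + y * I)))))) :
    IP = C * (∑ x ∈ S, r x * (((‖mellin f (-((x : ℝ) : ℂ))‖ ^ 2 : ℝ)) : ℂ)) + C * ((((2 * π)⁻¹ : ℝ) : ℂ) * ∫ t in Ioi (0 : ℝ),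
      (((‖mellin f (-((((1 / 2 : ℝ)) : ℂ) + t * I)) + c ((((1 / 2 : ℝ)) : ℂ) + ((-t : ℝ) : ℂ) * I) * mellin f (-((((1 / 2 : ℝ)) : ℂ) + ((-t : ℝ) : ℂ) * I))‖ ^ 2 : ℝ)) : ℂ)) := by
  obtain ⟨U, hUo, hUs, hc⟩ := exists_isOpen_differentiableOn_of_fe_of_conj_finset hcNF hPcd hFE hconj S hright
  have hUs' : {z : ℂ | 1 / 2 ≤ z.re ∧ z.re ≤ σ₀} ⊆ U := fun z hz => hUs hz.1
  have hIP' := pseudoEisenstein_contourShift_multi_of_letters hf hfs hf0 hf hfs hf0 hσ₀ hUo hUs' S hS hc r hr hB hIP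
  have hG : Integrable fun y : ℝ => mellin f (-((((1 / 2 : ℝ)) : ℂ) + y * I)) *
      (conj (mellin f (-(1 - conj ((((1 / 2 : ℝ)) : ℂ) + y * I)))) + c ((((1 / 2 : ℝ)) : ℂ) + y * I) * conj (mellin f (-conj ((((1 / 2 : ℝ)) : ℂ) + y * I)))) :=
    integrable_innerProductIntegrand_vertical_of_finset hf hfs hf0 hf hfs hf0 hσ₀ hUo hUs' hc (fun x hx => (hS x hx).1) hB (σ := 1 / 2) le_rfl hσ₀.le
      (fun x hx => ne_of_lt (hS x hx).1)
  exact plancherelNorm_of_innerProductFormula_finset S (fun x : ℝ => x) r (mellin f) c hIP' (norm_axis_eq_one_of_fe_of_conj hcNF hPcd hFE hconj)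
    (axis_reflect_of_fe_of_conj hcNF hPcd hFE hconj) hG

end Summit.HodgeConjecture.HodgeConjecture.Cruxes.H413.K2E1ChiUnitaryAxisContinuationCMTwo

end
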